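import Mathlib
import Literature.NumberTheory.LFunctions.Zhang2022.TypedSection13
import Literature.NumberTheory.LFunctions.Zhang2022.SkeletonAssembly
import Literature.NumberTheory.LFunctions.Zhang2022.Section5VerticalShift
import Literature.NumberTheory.LFunctions.SelbergClassDirichletProofs
import HarnessLib

/-!
# Zhang (2022) §13, the two "By Lemma 6.1" steps (conjugated approximate functional equation):
# `Z22:§13.u001` and `Z22:§13.u003` as kernel-checked EDGES from Lemma 6.1 and Proposition 2.2 (i)

Topic `Literature/NumberTheory/LFunctions/Zhang2022` (Landau–Siegel audit tree; verdict-neutral).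
Y. Zhang, *Discrete mean estimates and the Landau–Siegel zero*, arXiv:2211.02515v1 (2022)
[Zhang2022LandauSiegel], §13 p. 74 (tex L3739–3742 and L3755–3758), for `ψ ∈ Ψ₁`, `ρ ∈ 𝔷(ψ)`:

> By Lemma 6.1, `L(1−ρ−β₃,ψ̄) = \overline{L(ρ+β₃,ψ)} = K(1−ρ−β₃,ψ̄) + Z(ρ+β₃,ψ)⁻¹N(ρ+β₃,ψ)
> + O(E₁(ρ+β₃,ψ))`

> By Lemma 6.1 and 5.1, `(pt₀)^{β₁}L(1−ρ−β₂,ψ̄) = (pt₀)^{β₁}K(1−ρ−β₂,ψ̄)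
> + (pt₀)^{β₃}Z(ρ,ψ)⁻¹N(ρ+β₂,ψ) + O(N(ρ+β₂,ψ)𝓛⁻¹²³) + O(E₁(ρ+β₂,ψ))`

Campaign D-0069 (IUT playbook #2), DAG nodes `Z22:§13.u001`, `Z22:§13.u003`, typed statement-exact
as `Typed.Section13.U001 c′ c₀`, `Typed.Section13.U003 c′ c₀` (`TypedSection13.lean`, p411917).

**What is proved** (0 new facts, no Assumption (A) used):

* `Typed.Section13.u001_of : Skeleton.Prop22i → Skeleton.Lemma61 → ∀ c′, ∃ c₁ > 0, ∀ c₀ ≤ c₁,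
  U001 c′ c₀` — Lemma 6.1 (`Skeleton.Lemma61`, a CLAIM leaf; its `ε = exp{−c𝓛¹⁰}` fixes the
  admissible `c₀ ≤ c`) at `s = ρ+β₃`, CONJUGATED: on the critical line (Proposition 2.2 (i),
  `Skeleton.Prop22i`) `1 − ρ − β₃ = \overline{ρ+β₃}`, and `L(s̄,ψ̄) = \overline{L(s,ψ)}`,
  `K(s̄,ψ̄) = \overline{K(s,ψ)}`, `\overline{N(1−s,ψ̄)} = N(s,ψ)`, `\overline{Z(s,ψ)} = Z(s,ψ)⁻¹`
  (`|Z| = 1` on `σ = 1/2`);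
* the companion file `Section13U003.lean` does the same for `Z22:§13.u003` (at `s = ρ+β₂`, times
  `(pt₀)^{β₁}`, plus the "Lemma 5.1" vertical shift), importing the lemmas below.

Auxiliary, exported: `LFunction_inv_conj` (`L(s̄,ψ̄) = \overline{L(s,ψ)}`, from the tree's
`SelbergDirichlet.completedLFunction_conj`), `conj_Kchar`, `conj_Nchar_bar`, `conj_Zfac_eq_inv`.

WHAT THIS IS NOT: a proof of Lemma 6.1 or Proposition 2.2 themselves (CLAIM leaves of the cone);
any claim about Theorems 1–2 of the manuscript or about Landau–Siegel zeros.

## References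

* Y. Zhang, arXiv:2211.02515v1 (2022), §13 p. 74; §6 Lemma 6.1 p. 30; §5 Lemma 5.1 p. 24;
  §2 (2.2), (2.13), Prop. 2.2 (i). [cite: Zhang2022LandauSiegel, §13 p.74]
-/

noncomputable section

open Complex Real ComplexConjugate

namespace Literature.NumberTheory.LFunctions.Zhang2022.Typed.Section13

open Skeleton GammaFactor

/-! ## Conjugation symmetries -/

/-- **`L(w,ψ̄) = \overline{L(w̄,ψ)}`** for `ψ ∈ Ψ` (`ψ ≠ 1` to a prime modulus `p ≠ 1`), all `w`:
from the tree's `SelbergDirichlet.completedLFunction_conj` / `gammaFactor_conj` / `gammaFactor_inv`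
and Mathlib's `LFunction_eq_completed_div_gammaFactor`.
[cite: Zhang2022LandauSiegel, §13 p.74 ("`L(1−ρ−β₃,ψ̄) = \overline{L(ρ+β₃,ψ)}`")] -/
theorem LFunction_inv_conj {D : ℕ} (x : Chr D) (w : ℂ) :
    x.ψ⁻¹.LFunction w = conj (x.ψ.LFunction (conj w)) := by
  have hN : x.p ≠ 1 := x.p_ne_one
  rw [DirichletCharacter.LFunction_eq_completed_div_gammaFactor x.ψ⁻¹ w (Or.inr hN),
    DirichletCharacter.LFunction_eq_completed_div_gammaFactor x.ψ (conj w) (Or.inr hN), map_div₀,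
    SelbergDirichlet.completedLFunction_conj x.ψ_ne_one, SelbergDirichlet.gammaFactor_conj,
    Complex.conj_conj, SelbergDirichlet.gammaFactor_inv]

/-- `\overline{n^{−s}} = n^{−s̄}` for a natural number `n`. [folklore] -/
private theorem conj_natCast_cpow (n : ℕ) (s : ℂ) : conj ((n : ℂ) ^ s) = (n : ℂ) ^ conj s := by
  have h := Complex.conj_cpow (n : ℂ) (conj s) (by rw [Complex.natCast_arg]; exact pi_ne_zero.symm)
  rw [Complex.conj_conj, Complex.conj_natCast] at h
  exact h.symm

/-- **`\overline{K(s,ψ)} = K(s̄,ψ̄)`** (`K(s,θ) = Σ_n θ(n)n^{−s}g*(P₄/n)`, real weights `g*`).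
[cite: Zhang2022LandauSiegel, §6 Lemma 6.1; §13 p.74] -/
theorem conj_Kchar {D : ℕ} (x : Chr D) (s : ℂ) :
    conj (Kchar D (psiFn x) s) = Kchar D (psiBarFn x) (conj s) := by
  rw [Kchar, Kchar, map_sum]
  refine Finset.sum_congr rfl fun n _ => ?_
  rw [map_mul, map_mul, conj_natCast_cpow, map_neg, Complex.conj_ofReal]
  rfl

/-- **`\overline{N(w,ψ̄)} = N(w̄,ψ)`** (`N(w,θ) = Σ_n θ(n)n^{−w}g*(T²/n)`).
[cite: Zhang2022LandauSiegel, §6 Lemma 6.1; §13 p.74] -/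
theorem conj_Nchar_bar {D : ℕ} (x : Chr D) (w : ℂ) :
    conj (Nchar D (psiBarFn x) w) = Nchar D (psiFn x) (conj w) := by
  rw [Nchar, Nchar, map_sum]
  refine Finset.sum_congr rfl fun n _ => ?_
  rw [map_mul, map_mul, conj_natCast_cpow, map_neg, Complex.conj_ofReal]
  simp only [psiBarFn, psiFn, Complex.conj_conj]

/-- **`\overline{Z(s,ψ)} = Z(s,ψ)⁻¹` on the critical line** (`|Z(1/2+it,ψ)| = 1`, `t > 0`, `ψ`
primitive). [cite: Zhang2022LandauSiegel, §8 p.42 ("`|Z(s,ψχ)| = 1` if `σ = 1/2`")] -/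
theorem conj_Zfac_eq_inv {D : ℕ} (x : Chr D) {s : ℂ} (hre : s.re = 1 / 2) (him : 0 < s.im) :
    conj (Zfac x.ψ s) = (Zfac x.ψ s)⁻¹ := by
  have hs : s = 1 / 2 + (s.im : ℂ) * I := Complex.ext (by simp [hre]) (by simp)
  have h1 : ‖Zfac x.ψ s‖ = 1 := by rw [hs]; exact norm_Zfac_half_eq_one x.prim him
  rw [Complex.inv_eq_conj h1]

/-- On the critical line `1 − s = s̄`. [cite: Zhang2022LandauSiegel, §13 p.74] -/
private theorem one_sub_eq_conj {s : ℂ} (hs : s.re = 1 / 2) : 1 - s = conj s := by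
  apply Complex.ext
  · simp [hs]; norm_num
  · simp

/-! ## Lemma 6.1, conjugated on the critical line -/

/-- **Lemma 6.1 conjugated**: if `Re s = 1/2`, `Im s > 0`, then
`‖L(s̄,ψ̄) − K(s̄,ψ̄) − Z(s,ψ)⁻¹N(s,ψ)‖ = ‖L(s,ψ) − K(s,ψ) − Z(s,ψ)N(1−s,ψ̄)‖` (`s̄ = 1 − s`).
[cite: Zhang2022LandauSiegel, §13 p.74; §6 Lemma 6.1] -/
theorem norm_afe_conj_eq {D : ℕ} (x : Chr D) {s : ℂ} (hre : s.re = 1 / 2) (him : 0 < s.im) :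
    ‖x.ψ⁻¹.LFunction (conj s) - Kchar D (psiBarFn x) (conj s) -
        (Zfac x.ψ s)⁻¹ * Nchar D (psiFn x) s‖ =
      ‖x.ψ.LFunction s - Kchar D (psiFn x) s - Zfac x.ψ s * Nchar D (psiBarFn x) (1 - s)‖ := by
  have h : x.ψ⁻¹.LFunction (conj s) - Kchar D (psiBarFn x) (conj s) -
      (Zfac x.ψ s)⁻¹ * Nchar D (psiFn x) s =
      conj (x.ψ.LFunction s - Kchar D (psiFn x) s - Zfac x.ψ s * Nchar D (psiBarFn x) (1 - s)) := by
    rw [map_sub, map_sub, map_mul, LFunction_inv_conj, Complex.conj_conj, conj_Kchar,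
      conj_Zfac_eq_inv x hre him, conj_Nchar_bar, one_sub_eq_conj hre, Complex.conj_conj]
  rw [h, Complex.norm_conj]

/-! ## Parameter bookkeeping (as in `Section13Eq131a`, `Section13U002`) -/

/-- `β₁ = iv₁`, `v₁ = α(1−5c′α𝓛)`. [cite: Zhang2022LandauSiegel, §2 (2.13)] -/
private theorem beta1_eq'' (c' : ℝ) (D : ℕ) :
    beta1 c' D = ((alpha D * (1 - 5 * c' * alpha D * ell D) : ℝ) : ℂ) * I := by
  simp only [beta1]; push_cast; ring

/-- `β₂ = iv₂`, `v₂ = 2α(1+c′α𝓛)`. [cite: Zhang2022LandauSiegel, §2 (2.13)] -/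
private theorem beta2_eq'' (c' : ℝ) (D : ℕ) :
    beta2 c' D = ((2 * alpha D * (1 + c' * alpha D * ell D) : ℝ) : ℂ) * I := by
  simp only [beta2]; push_cast; ring

/-- `β₃ = iv₃`, `v₃ = 3α(1−c′α𝓛)`. [cite: Zhang2022LandauSiegel, §2 (2.13)] -/
private theorem beta3_eq'' (c' : ℝ) (D : ℕ) :
    beta3 c' D = ((3 * alpha D * (1 - c' * alpha D * ell D) : ℝ) : ℂ) * I := by
  simp only [beta3]; push_cast; ring

/-- `α = π/𝓛⁹` ((2.10), `P = exp 𝓛⁹`). [cite: Zhang2022LandauSiegel, §2 (2.10)] -/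
private theorem alpha_eq'' (D : ℕ) : alpha D = π / ell D ^ 9 := by
  rw [alpha, bigP, Real.log_exp]

/-- For `𝓛 ≥ 1`: `0 < α`, `α𝓛 ≤ π` and `α ≤ π/𝓛`. [cite: Zhang2022LandauSiegel, §2 (2.10)] -/
private theorem alpha_bounds'' {D : ℕ} (hℓ : 1 ≤ ell D) :
    0 < alpha D ∧ 0 ≤ alpha D * ell D ∧ alpha D * ell D ≤ π ∧ alpha D ≤ π / ell D := by
  have hℓ0 : 0 < ell D := by linarith
  have h9 : 1 ≤ ell D ^ 9 := one_le_pow₀ hℓ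
  have hα : alpha D = π / ell D ^ 9 := alpha_eq'' D
  have hαpos : 0 < alpha D := by rw [hα]; positivity
  have h8 : ell D ≤ ell D ^ 9 := by
    calc ell D = ell D ^ 1 := (pow_one _).symm
      _ ≤ ell D ^ 9 := pow_le_pow_right₀ hℓ (by norm_num)
  have hαℓ : alpha D * ell D ≤ π := by
    calc alpha D * ell D ≤ alpha D * ell D ^ 9 := by gcongr
      _ = π := by rw [hα, div_mul_cancel₀ _ (by positivity)]
  refine ⟨hαpos, by positivity, hαℓ, ?_⟩
  rw [le_div_iff₀ hℓ0]; exact hαℓ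

/-- `|v_j| ≤ 3αK`, `K = 1 + 5π|c′|`, for `j = 1, 2, 3` (`𝓛 ≥ 1`). [cite: Zhang2022LandauSiegel, §2 (2.13)] -/
private theorem abs_v_le'' {c' : ℝ} {D : ℕ} (hℓ : 1 ≤ ell D) :
    |alpha D * (1 - 5 * c' * alpha D * ell D)| ≤ 3 * alpha D * (1 + 5 * π * |c'|) ∧
      |2 * alpha D * (1 + c' * alpha D * ell D)| ≤ 3 * alpha D * (1 + 5 * π * |c'|) ∧
      |3 * alpha D * (1 - c' * alpha D * ell D)| ≤ 3 * alpha D * (1 + 5 * π * |c'|) := by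
  obtain ⟨hαpos, hαℓ0, hαℓ, -⟩ := alpha_bounds'' hℓ
  have hc : 0 ≤ |c'| := abs_nonneg _
  have hπ : 0 ≤ π := pi_pos.le
  have hb : ∀ k : ℝ, 0 ≤ k → k ≤ 5 → |k * c' * alpha D * ell D| ≤ 5 * π * |c'| := by
    intro k hk0 hk5
    rw [show k * c' * alpha D * ell D = k * c' * (alpha D * ell D) by ring, abs_mul, abs_mul,
      abs_of_nonneg hk0, abs_of_nonneg hαℓ0]
    calc k * |c'| * (alpha D * ell D) ≤ 5 * |c'| * π := by gcongr
      _ = 5 * π * |c'| := by ring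
  have hgen : ∀ (m k : ℝ) (sgn : Bool), 0 ≤ m → m ≤ 3 → 0 ≤ k → k ≤ 5 →
      |m * alpha D * (1 + (if sgn then 1 else -1) * (k * c' * alpha D * ell D))| ≤
        3 * alpha D * (1 + 5 * π * |c'|) := by
    intro m k sgn hm0 hm3 hk0 hk5
    rw [abs_mul, abs_of_nonneg (by positivity : 0 ≤ m * alpha D)]
    have h1 : |1 + (if sgn then 1 else -1 : ℝ) * (k * c' * alpha D * ell D)| ≤ 1 + 5 * π * |c'| := by
      have h2 : |(if sgn then 1 else -1 : ℝ) * (k * c' * alpha D * ell D)| =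
          |k * c' * alpha D * ell D| := by
        rw [abs_mul]; cases sgn <;> simp
      have h3 := abs_add_le (1 : ℝ) ((if sgn then 1 else -1 : ℝ) * (k * c' * alpha D * ell D))
      rw [abs_one, h2] at h3
      linarith [hb k hk0 hk5]
    exact mul_le_mul (by nlinarith) h1 (abs_nonneg _) (by positivity)
  refine ⟨?_, ?_, ?_⟩
  · have := hgen 1 5 false (by norm_num) (by norm_num) (by norm_num) le_rfl
    simp only [Bool.false_eq_true, if_false] at this
    convert this using 2; ring
  · have := hgen 2 1 true (by norm_num) (by norm_num) (by norm_num) (by norm_num)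
    simp only [if_true] at this
    convert this using 2; ring
  · have := hgen 3 1 false (by norm_num) le_rfl (by norm_num) (by norm_num)
    simp only [Bool.false_eq_true, if_false] at this
    convert this using 2; ring

/-! ## Large-`D` bookkeeping shared by the two edges -/

/-- For `D ≥ ⌈exp M⌉` with `M ≥ 4`: `4 ≤ M ≤ 𝓛 ≤ t₀`, `𝓛₁ ≤ t₀`, `𝓛 > 0`.
[cite: Zhang2022LandauSiegel, §2 (2.8)] -/
private theorem largeD {M : ℝ} {D : ℕ} (hM4 : 4 ≤ M) (hD : ⌈Real.exp M⌉₊ ≤ D) :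
    M ≤ ell D ∧ 1 ≤ ell D ∧ ell D ≤ t0 D ∧ ell1 D ≤ t0 D ∧ 0 < t0 D := by
  have hDreal : Real.exp M ≤ (D : ℝ) := le_trans (Nat.le_ceil _) (by exact_mod_cast hD)
  have hDpos : (0 : ℝ) < D := lt_of_lt_of_le (Real.exp_pos M) hDreal
  have hℓM : M ≤ ell D := by rw [ell]; exact (Real.le_log_iff_exp_le hDpos).mpr hDreal
  have hℓ1 : 1 ≤ ell D := by linarith
  have ht0ℓ : ell D ≤ t0 D := by rw [t0]; exact le_self_pow₀ hℓ1 (by norm_num)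
  have hℓ1t0 : ell1 D ≤ t0 D := by rw [ell1, t0]; exact pow_le_pow_right₀ hℓ1 (by norm_num)
  exact ⟨hℓM, hℓ1, ht0ℓ, hℓ1t0, by linarith⟩

/-- A zero `ρ ∈ 𝔷(ψ)` has `t₀ ≤ Im ρ` (once `𝓛₁ ≤ t₀`, `t₀ ≥ 0`).
[cite: Zhang2022LandauSiegel, §2 (2.14)] -/
private theorem t0_le_im {D : ℕ} {x : Chr D} {ρ : ℂ} (hρ : ρ ∈ zeroSet D x)
    (hℓ1t0 : ell1 D ≤ t0 D) (ht0 : 0 < t0 D) : t0 D ≤ ρ.im := by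
  obtain ⟨-, him, -⟩ := hρ
  have h1 := (abs_lt.mp him).1
  have hπ : (3 : ℝ) < π := Real.pi_gt_three
  nlinarith

/-! ## `Z22:§13.u001` -/

/-- **`Z22:§13.u001` as a kernel-checked EDGE** [Z22 p.74, display after (13.1), tex L3739–3742]:
Proposition 2.2 (i) and Lemma 6.1 imply `U001 c′ c₀` for every `c′` and every `c₀ ≤ c₁`, where
`c₁ > 0` is the constant `c` in Lemma 6.1's `ε = exp{−c𝓛¹⁰}`: for `D` large, `ψ ∈ Ψ₁`,
`ρ ∈ 𝔷(ψ)`, `L(1−ρ−β₃,ψ̄) = \overline{L(ρ+β₃,ψ)}` EXACTLY and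
`‖L(1−ρ−β₃,ψ̄) − K(1−ρ−β₃,ψ̄) − Z(ρ+β₃,ψ)⁻¹N(ρ+β₃,ψ)‖ ≤ C·E₁(ρ+β₃,ψ)` (`E₁ = E1full c₀`).
[cite: Zhang2022LandauSiegel, §13 p.74] -/
theorem u001_of (h22 : Prop22i) (h61 : Lemma61) (c' : ℝ) :
    ∃ c₁ : ℝ, 0 < c₁ ∧ ∀ c₀ : ℝ, c₀ ≤ c₁ → U001 c' c₀ := by
  obtain ⟨c, hc, C₁, D₆, h61⟩ := h61
  obtain ⟨D₂, h22⟩ := h22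
  refine ⟨c, hc, fun c₀ hc₀ => ?_⟩
  set K : ℝ := 1 + 5 * π * |c'| with hK
  have hK1 : 1 ≤ K := by rw [hK]; nlinarith [pi_pos, abs_nonneg c']
  set M : ℝ := 4 + 3 * π * K with hM
  have hM4 : 4 ≤ M := by rw [hM]; nlinarith [pi_pos]
  refine ⟨max C₁ 0, max (max D₆ D₂) ⌈Real.exp M⌉₊, fun D _ χ hD hq hp _ x hx ρ hρ => ?_⟩
  have hD₆ : D₆ ≤ D := le_trans (le_trans (le_max_left _ _) (le_max_left _ _)) hD
  have hD₂ : D₂ ≤ D := le_trans (le_trans (le_max_right _ _) (le_max_left _ _)) hD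
  have hDM : ⌈Real.exp M⌉₊ ≤ D := le_trans (le_max_right _ _) hD
  obtain ⟨hℓM, hℓ1, ht0ℓ, hℓ1t0, ht0pos⟩ := largeD hM4 hDM
  have hℓpos : 0 < ell D := by linarith
  -- the point `s = ρ + β₃` on the critical line
  have hre : ρ.re = 1 / 2 := h22 D χ hD₂ hq hp x hx ρ (mem_prodZeroSetOmega_of_mem_zeroSet χ hρ)
  have htt0 : t0 D ≤ ρ.im := t0_le_im hρ hℓ1t0 ht0pos
  obtain ⟨-, him, -⟩ := hρ
  set s : ℂ := ρ + beta3 c' D with hs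
  obtain ⟨hav1, hav2, hav3⟩ := abs_v_le'' (c' := c') hℓ1
  obtain ⟨hαpos, -, -, hαπℓ⟩ := alpha_bounds'' hℓ1
  have hv3small : |3 * alpha D * (1 - c' * alpha D * ell D)| ≤ 1 := by
    refine le_trans hav3 ?_
    calc 3 * alpha D * K ≤ 3 * (π / ell D) * K := by gcongr
      _ = (3 * π * K) / ell D := by ring
      _ ≤ 1 := by rw [div_le_one hℓpos]; linarith
  have hsre : s.re = 1 / 2 := by
    rw [hs, Complex.add_re, hre, beta3_eq'', Complex.mul_re, Complex.ofReal_re, Complex.ofReal_im,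
      Complex.I_re, Complex.I_im]; ring
  have hsim : s.im = ρ.im + 3 * alpha D * (1 - c' * alpha D * ell D) := by
    rw [hs, Complex.add_im, beta3_eq'', Complex.mul_im, Complex.ofReal_re, Complex.ofReal_im,
      Complex.I_re, Complex.I_im]; ring
  have hsim_pos : 0 < s.im := by
    rw [hsim]; have := (abs_le.mp hv3small).1; linarith
  have hsrange1 : |s.re - 1 / 2| < 2 * alpha D := by
    rw [hsre, sub_self, abs_zero]; linarith
  have hsrange2 : |s.im - 2 * π * t0 D| < ell1 D + 2 := by
    rw [hsim]
    calc |ρ.im + 3 * alpha D * (1 - c' * alpha D * ell D) - 2 * π * t0 D|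
        = |(ρ.im - 2 * π * t0 D) + 3 * alpha D * (1 - c' * alpha D * ell D)| := by ring_nf
      _ ≤ |ρ.im - 2 * π * t0 D| + |3 * alpha D * (1 - c' * alpha D * ell D)| := abs_add_le _ _
      _ < ell1 D + 2 := by linarith
  -- Lemma 6.1 at `s`, conjugated
  have h61s := h61 D χ hD₆ hq hp x s hsrange1 hsrange2
  have hconj : 1 - ρ - beta3 c' D = conj s := by rw [hs, ← one_sub_eq_conj hsre]; ring
  refine ⟨?_, ?_⟩
  · rw [hconj, LFunction_inv_conj, Complex.conj_conj]
  · rw [hconj, norm_afe_conj_eq x hsre hsim_pos]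
    have hE : E1main x s + Real.exp (-c * ell D ^ 10) ≤ E1full c₀ x s := by
      rw [E1full]
      have : Real.exp (-c * ell D ^ 10) ≤ Real.exp (-c₀ * ell D ^ 10) := by
        apply Real.exp_le_exp.mpr
        have : 0 ≤ ell D ^ 10 := by positivity
        nlinarith
      linarith
    have hE0 : 0 ≤ E1main x s + Real.exp (-c * ell D ^ 10) :=
      add_nonneg (E1main_nonneg x s) (Real.exp_nonneg _)
    calc _ ≤ C₁ * (E1main x s + Real.exp (-c * ell D ^ 10)) := h61s
      _ ≤ max C₁ 0 * (E1main x s + Real.exp (-c * ell D ^ 10)) :=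
          mul_le_mul_of_nonneg_right (le_max_left _ _) hE0
      _ ≤ max C₁ 0 * E1full c₀ x s := mul_le_mul_of_nonneg_left hE (le_max_right _ _)

end Literature.NumberTheory.LFunctions.Zhang2022.Typed.Section13
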